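import Mathlib
import Summits.NavierStokesRegularity.NavierStokesRegularity.Theorems.EulerZoomLiouvillePowerGaugeEulerLiouvilleSelfSimilarHalfOrbitKill
import Summits.NavierStokesRegularity.NavierStokesRegularity.Theorems.EulerZoomLiouvillePowerGaugeEulerLiouvilleSelfSimilarBoundedLoc
import Summits.NavierStokesRegularity.NavierStokesRegularity.Theorems.EulerZoomLiouvillePowerGaugeEulerLiouvilleSelfSimilarIrrotationalGrowth
import HarnessLib.Audit

/-!
# Rung C1 of the crux `EulerZoomLiouville.PowerGaugeEulerLiouville` (sub-stratum W3c): THE ONE-SIDED RADIAL BARRIER —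
# a `C²` self-similar Euler profile with NO FAST INFLOW at infinity is irrotational, hence trivial as a member

Route №10 `EulerZoomLiouville` (NavierStokesRegularity), crux E = stmt-NavierStokesRegularity-19832, tenure rung C1,
registered residue `stub_selfSimilarExtremalRest` (v19: `¬ IsTameC2Profile ρ V`), sub-stratum W3c («`C²`, rotational, not
uniformly continuous, `limsup ‖V(y)‖/‖y‖ ≥ γ` along a radially thin set»).  Lineage ns-typeII-p1 (gen 8); lever suggested
from the LEAD side (ns-typeII-p2 g9, 01:14Z).

The barrier of the cutoff localisation needs only the RADIAL component of the profile: if `⟪y, U(y)⟫ ≥ −κ‖y‖²` for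
`‖y‖ ≥ R₁` with `κ < γ` — the profile does not suck fluid INWARD faster than the similarity drift `γy` pushes it outward;
outward and tangential components are unrestricted, so `U` may grow arbitrarily fast — then every large sphere is a barrier
for the backward similarity flow (`norm_flow_le_max_of_nonpos_of_inner`).  The price of dropping linear growth: no global
`W`-curve through a point need exist (forward orbits may blow up), so the limit-set kill runs on HALF-orbits
(`…SelfSimilarHalfOrbitKit` / `…SelfSimilarHalfOrbitKill`, ODE on `[0,∞)` only).  With the LEAD's growth-free Liouville
endgame (`Loc.selfSimilar_ae_eq_zero_of_irrotationalC2_profile`, p592386: `curl V ≡ 0` + the member's own `A`-gauge ⇒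
`u = 0`), the member-level conclusion needs nothing else.

* `exists_cutoff_local_smul` — cutoff `Ṽ = χU` recorded as `Ṽ y = c • U y`, `0 ≤ c ≤ 1` (radial one-sided bounds transfer);
* `norm_flow_le_max_of_nonpos_of_inner` — the one-sided radial barrier;
* **`curl_eq_zero_of_radialInflow`** — `(U, P)` a `C²` profile of CIV (3.3), `0 < γ < ½`, `⟪y, U y⟫ ≥ −κ‖y‖²` for
  `‖y‖ ≥ R₁`, `κ < γ` ⇒ `curl U ≡ 0` (contains `curl_eq_zero_of_subdrift`: `‖U y‖ ≤ κ‖y‖` ⇒ `⟪y, U y⟫ ≥ −κ‖y‖²`);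
* **`selfSimilar_ae_eq_zero_of_radialInflowC2_profile`** — MEMBER LEVEL, crux hypotheses verbatim (`0 < ρ ≤ ½`) + exact
  self-similarity + `V ∈ C²` + `⟪y, V y⟫ ≥ −κ‖y‖²` near infinity for some `κ < 1/(2+ρ)` ⇒ `u = 0` a.e.

WHAT THIS IS NOT: not NS, not E, not rung C1 — `C²` profiles whose INWARD radial velocity reaches `γ‖y‖` along a sequence
`‖y‖ → ∞` (necessarily on a radially thin set, by the `A`-gauge), the weak class (`V ∉ C²`) and all non-self-similar members
remain. [folklore; ConstantinIgnatovaVicol2026Putative §3.4–§3.5 (setting)]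
-/

noncomputable section

-- flat `Theorems/<Route><Decl>…` files of one crux share the namespace of the crux (tree convention)
set_option linter.dupNamespace false

open MeasureTheory Set Filter Topology Metric Function InnerProductSpace
open scoped RealInnerProductSpace NNReal ENNReal ContDiff

namespace Summit.NavierStokesRegularity.NavierStokesRegularity.Theorems.PowerGaugeEulerLiouville.Loc

open Literature.Analysis Literature.Analysis.FluidPDE
open Summit.NavierStokesRegularity.NavierStokesRegularity.Theorems.PowerGaugeEulerLiouville.Kelvin

variable {γ : ℝ} {U : EuclideanSpace ℝ (Fin 3) → EuclideanSpace ℝ (Fin 3)} {P : EuclideanSpace ℝ (Fin 3) → ℝ}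

/-! ### Cutoff with a scalar factor; the one-sided radial barrier -/

/-- **Cutoff with a scalar factor**: a `C²` field `U` agrees on `ball 0 R` with a `C²` field `Ṽ = χ U` that is BOUNDED, has
GLOBALLY bounded gradient, and is everywhere a multiple `c • U y`, `0 ≤ c ≤ 1`, of `U y` (so one-sided radial bounds on `U`
transfer to `Ṽ`). [folklore] -/
theorem exists_cutoff_local_smul (hU : ContDiff ℝ 2 U) {R : ℝ} (hR : 0 < R) :
    ∃ V : EuclideanSpace ℝ (Fin 3) → EuclideanSpace ℝ (Fin 3), ContDiff ℝ 2 V ∧ (∃ M : ℝ, ∀ y, ‖V y‖ ≤ M) ∧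
      (∀ y, ∃ c : ℝ, 0 ≤ c ∧ c ≤ 1 ∧ V y = c • U y) ∧ (∃ K : ℝ, ∀ y, ‖fderiv ℝ V y‖ ≤ K) ∧
      ∀ y ∈ ball (0 : EuclideanSpace ℝ (Fin 3)) R, V y = U y := by
  let χ : ContDiffBump (0 : EuclideanSpace ℝ (Fin 3)) := ⟨R, R + 1, hR, by linarith⟩
  set V : EuclideanSpace ℝ (Fin 3) → EuclideanSpace ℝ (Fin 3) := fun y => χ y • U y with hVdef
  have hV : ContDiff ℝ 2 V := (χ.contDiff (n := 2)).smul hU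
  -- `V` vanishes identically near every point outside `closedBall 0 (R+1)`
  have hzero : ∀ y : EuclideanSpace ℝ (Fin 3), R + 1 < ‖y‖ → V =ᶠ[𝓝 y] fun _ => 0 := by
    intro y hy
    have hopen : IsOpen {y' : EuclideanSpace ℝ (Fin 3) | R + 1 < ‖y'‖} := isOpen_lt continuous_const continuous_norm
    filter_upwards [hopen.mem_nhds hy] with y' hy'
    have hns : y' ∉ Function.support (χ : EuclideanSpace ℝ (Fin 3) → ℝ) := by
      rw [χ.support_eq, mem_ball, dist_zero_right]
      exact not_lt.2 (le_of_lt hy')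
    rw [Function.notMem_support] at hns
    simp [hVdef, hns]
  refine ⟨V, hV, ?_, fun y => ?_, ?_, fun y hy => ?_⟩
  · obtain ⟨C, hC⟩ := (isCompact_closedBall (0 : EuclideanSpace ℝ (Fin 3)) (R + 2)).exists_bound_of_continuousOn
      hV.continuous.continuousOn
    refine ⟨max C 0, fun y => ?_⟩
    by_cases hy : ‖y‖ ≤ R + 2
    · exact (hC y (by rwa [mem_closedBall, dist_zero_right])).trans (le_max_left _ _)
    · push Not at hy
      rw [(hzero y (by linarith)).self_of_nhds, norm_zero]
      exact le_max_right _ _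
  · exact ⟨χ y, χ.nonneg, χ.le_one, rfl⟩
  · have hDVc : Continuous (fderiv ℝ V) := hV.continuous_fderiv (by norm_num)
    obtain ⟨C, hC⟩ := (isCompact_closedBall (0 : EuclideanSpace ℝ (Fin 3)) (R + 2)).exists_bound_of_continuousOn
      hDVc.continuousOn
    refine ⟨max C 0, fun y => ?_⟩
    by_cases hy : ‖y‖ ≤ R + 2
    · exact (hC y (by rwa [mem_closedBall, dist_zero_right])).trans (le_max_left _ _)
    · push Not at hy
      rw [(hzero y (by linarith)).fderiv_eq, fderiv_const_apply, norm_zero]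
      exact le_max_right _ _
  · rw [mem_ball, dist_zero_right] at hy
    have h1 : χ y = 1 := χ.one_of_mem_closedBall (by rw [mem_closedBall, dist_zero_right]; exact hy.le)
    simp [hVdef, h1]

/-- **ONE-SIDED RADIAL BARRIER**: for a `C¹` field `Ṽ` with `‖DṼ‖ ≤ K` and `⟪y, Ṽ y⟫ ≥ −κ‖y‖²` whenever `‖y‖ ≥ R`, with
`κ < γ` (`R > 0`) — NO INWARD radial velocity faster than `κ‖y‖` at infinity; the outward and tangential parts of `Ṽ` are
free —, every backward orbit of `W = γy + Ṽ` satisfies `‖Φ_s x‖ ≤ max ‖x‖ R` for `s ≤ 0`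
(`d/ds ‖Φ_s x‖² = 2γ‖Y‖² + 2⟪Y, ṼY⟫ ≥ 2(γ−κ)‖Y‖² > 0` outside the ball `R`; fencing lemma). [folklore] -/
theorem norm_flow_le_max_of_nonpos_of_inner {V : EuclideanSpace ℝ (Fin 3) → EuclideanSpace ℝ (Fin 3)}
    (hV : ContDiff ℝ 1 V) {K : ℝ} (hK : ∀ y, ‖fderiv ℝ V y‖ ≤ K) {κ : ℝ} (hκ : κ < γ) {R : ℝ} (hR : 0 < R)
    (hfar : ∀ y, R ≤ ‖y‖ → -(κ * ‖y‖ ^ 2) ≤ ⟪y, V y⟫) (x : EuclideanSpace ℝ (Fin 3)) {s : ℝ} (hs : s ≤ 0) :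
    ‖ODE.evolutionMap (fun _ : ℝ => selfSimilarTransport γ 0 V) 0 s x‖ ≤ max ‖x‖ R := by
  set Φ := ODE.evolutionMap (fun _ : ℝ => selfSimilarTransport γ 0 V) 0 with hΦ
  set m : ℝ := max ‖x‖ R with hm
  have hm0 : 0 < m := lt_max_of_lt_right hR
  -- `g t = ‖Φ_{−t} x‖²`, `g' t = 2⟪Y, −W(Y)⟫`
  set g : ℝ → ℝ := fun t => ‖Φ (-t) x‖ ^ 2 with hg
  set g' : ℝ → ℝ := fun t => 2 * ⟪Φ (-t) x, (-1 : ℝ) • selfSimilarTransport γ 0 V (Φ (-t) x)⟫ with hg'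
  have hder : ∀ t, HasDerivAt g (g' t) t := fun t =>
    (C2.Kelvin.hasDerivAt_flow_neg (γ := γ) hV hK x t).norm_sq
  have key : ∀ b : ℝ, ∀ ⦃t⦄, t ∈ Icc 0 b → g t ≤ m ^ 2 := by
    intro b
    refine image_le_of_deriv_right_lt_deriv_boundary' (f := g) (f' := g') (a := 0) (b := b)
      (fun t _ => (hder t).continuousAt.continuousWithinAt) (fun t _ => (hder t).hasDerivWithinAt)
      (B := fun _ => m ^ 2) (B' := fun _ => 0) ?_ continuousOn_const (fun t _ => (hasDerivAt_const t _).hasDerivWithinAt) ?_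
    · -- `g 0 = ‖x‖² ≤ m²`
      have h0 : g 0 = ‖x‖ ^ 2 := by simp [hg, hΦ, ODE.evolutionMap_self]
      rw [h0]
      exact pow_le_pow_left₀ (norm_nonneg _) (le_max_left _ _) 2
    · -- on the barrier the derivative is negative
      intro t _ hgt
      set Y := Φ (-t) x with hY
      have hYn : ‖Y‖ = m := by
        have h1 : ‖Y‖ ^ 2 = m ^ 2 := hgt
        exact (pow_left_inj₀ (norm_nonneg Y) hm0.le two_ne_zero).1 h1
      have hRY : R ≤ ‖Y‖ := by rw [hYn]; exact le_max_right _ _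
      have hinner : -(κ * ‖Y‖ ^ 2) ≤ ⟪Y, V Y⟫ := hfar Y hRY
      have hcalc : g' t = -(2 * γ * ‖Y‖ ^ 2) - 2 * ⟪Y, V Y⟫ := by
        simp only [hg', ← hY, selfSimilarTransport_apply, sub_zero, inner_smul_right, inner_add_right,
          real_inner_self_eq_norm_sq]
        ring
      rw [hcalc]
      have hm2 : 0 < ‖Y‖ ^ 2 := by rw [hYn]; positivity
      have hγκ : 0 < γ - κ := by linarith
      nlinarith [mul_pos hγκ hm2]
  have ht : -s ∈ Icc (0 : ℝ) (-s) := ⟨neg_nonneg.2 hs, le_rfl⟩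
  have h := key (-s) ht
  simp only [hg, neg_neg] at h
  exact (pow_le_pow_iff_left₀ (norm_nonneg _) hm0.le two_ne_zero).1 h

/-! ### No fast inflow ⇒ irrotational -/

/-- **A `C²` SELF-SIMILAR EULER PROFILE WITH NO FAST INFLOW AT INFINITY IS IRROTATIONAL** (`0 < γ < ½`): `(U, P)` satisfies
CIV (3.3) and `⟪y, U y⟫ ≥ −κ‖y‖²` for `‖y‖ ≥ R₁` with `κ < γ` ⇒ `curl U x₀ = 0` for every `x₀`.  Cutoff localisation around the
barrier ball of `ball x₀ 1`, limit-set kill on the backward HALF-orbit, profile-free no-drift lemma, thin bad nodes.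
[folklore; three-lineage chain of the ns-regularity-ideate cell, localised, half-orbit form] -/
theorem curl_eq_zero_of_radialInflow (hprof : IsSelfSimilarEulerProfile γ 0 U P)
    {κ R₁ : ℝ} (hκ : κ < γ) (hR₁ : ∀ y : EuclideanSpace ℝ (Fin 3), R₁ ≤ ‖y‖ → -(κ * ‖y‖ ^ 2) ≤ ⟪y, U y⟫)
    (hγ : 0 < γ) (hγ2 : γ < 1 / 2) (x₀ : EuclideanSpace ℝ (Fin 3)) : curl U x₀ = 0 := by
  have hU2 : ContDiff ℝ 2 U := hprof.contDiff_velocity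
  have hU1 : ContDiff ℝ 1 U := hU2.of_le (by norm_num)
  have hγne : γ ≠ 1 / 2 := ne_of_lt hγ2
  -- `κ ≥ 0` may be assumed; the barrier radius `R ≥ 1`
  have hκ0 : max κ 0 < γ := max_lt hκ hγ
  set R : ℝ := max R₁ 1 with hRdef
  have hR : 0 < R := lt_of_lt_of_le one_pos (le_max_right _ _)
  have hfarU : ∀ y : EuclideanSpace ℝ (Fin 3), R ≤ ‖y‖ → -(max κ 0 * ‖y‖ ^ 2) ≤ ⟪y, U y⟫ := by
    intro y hy
    have h1 := hR₁ y ((le_max_left _ _).trans hy)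
    have h2 : κ * ‖y‖ ^ 2 ≤ max κ 0 * ‖y‖ ^ 2 := mul_le_mul_of_nonneg_right (le_max_left _ _) (sq_nonneg _)
    linarith
  set R₀ : ℝ := max (‖x₀‖ + 1) R with hR₀def
  have hR₀ : 0 < R₀ := lt_of_lt_of_le hR (le_max_right _ _)
  have hRR₀ : R ≤ R₀ := le_max_right _ _
  -- the cutoff field (equal to `U` on `ball 0 (R₀+1)`, a multiple of `U` everywhere)
  obtain ⟨V, hV, ⟨M, hVM⟩, hVmul, ⟨K, hK⟩, hagree⟩ := exists_cutoff_local_smul hU2 (R := R₀ + 1) (by linarith)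
  have hV1 : ContDiff ℝ 1 V := hV.of_le (by norm_num)
  have hfarV : ∀ y : EuclideanSpace ℝ (Fin 3), R ≤ ‖y‖ → -(max κ 0 * ‖y‖ ^ 2) ≤ ⟪y, V y⟫ := by
    intro y hy
    obtain ⟨c, hc0, hc1, hcy⟩ := hVmul y
    rw [hcy, inner_smul_right]
    have h1 := hfarU y hy
    have h2 : 0 ≤ max κ 0 * ‖y‖ ^ 2 := mul_nonneg (le_max_right _ _) (sq_nonneg _)
    nlinarith
  have hnear : ∀ z : EuclideanSpace ℝ (Fin 3), ‖z‖ ≤ R₀ → V =ᶠ[𝓝 z] U := by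
    intro z hz
    have hmem : ball (0 : EuclideanSpace ℝ (Fin 3)) (R₀ + 1) ∈ 𝓝 z :=
      isOpen_ball.mem_nhds (by rw [mem_ball, dist_zero_right]; linarith)
    exact Filter.eventually_of_mem hmem fun y hy => hagree y hy
  have hDeq : ∀ z : EuclideanSpace ℝ (Fin 3), ‖z‖ ≤ R₀ → fderiv ℝ V z = fderiv ℝ U z :=
    fun z hz => (hnear z hz).fderiv_eq
  have hcurlEq : ∀ z : EuclideanSpace ℝ (Fin 3), ‖z‖ ≤ R₀ → curl V z = curl U z :=
    fun z hz => curl_congr_fderiv (hDeq z hz)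
  have hWeq : ∀ z : EuclideanSpace ℝ (Fin 3), ‖z‖ < R₀ + 1 →
      selfSimilarTransport γ 0 V z = selfSimilarTransport γ 0 U z := by
    intro z hz
    simp only [selfSimilarTransport_apply, hagree z (by rwa [mem_ball, dist_zero_right])]
  set Φ := ODE.evolutionMap (fun _ : ℝ => selfSimilarTransport γ 0 V) 0 with hΦ
  -- the bad set of `V` inside the closed ball `R₀`
  set Bd : Set (EuclideanSpace ℝ (Fin 3)) := {z | z ∈ selfSimilarNodalSet γ 0 V ∧ ‖z‖ ≤ R₀ ∧
    ∃ w : EuclideanSpace ℝ (Fin 3), ‖w‖ = 1 ∧ 1 ≤ ⟪fderiv ℝ V z w, w⟫} with hBd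
  have hBc : IsCompact Bd := by
    have hWc : Continuous (selfSimilarTransport γ 0 V) := (contDiff_selfSimilarTransport (γ := γ) hV).continuous
    have h1 : IsClosed (selfSimilarNodalSet γ 0 V) := isClosed_eq hWc continuous_const
    have h2 : IsClosed {z : EuclideanSpace ℝ (Fin 3) | ‖z‖ ≤ R₀} := isClosed_le continuous_norm continuous_const
    have h3 := isClosed_badSet_of_contDiff hV1
    have hcl : IsClosed Bd := by
      rw [hBd, setOf_and, setOf_and]
      exact h1.inter (h2.inter h3)
    refine (isCompact_closedBall (0 : EuclideanSpace ℝ (Fin 3)) R₀).of_isClosed_subset hcl fun z hz => ?_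
    rw [mem_closedBall, dist_zero_right]; exact hz.2.1
  -- every point of `Bd` is thin for the `V`-flow
  have hthin : ∀ z ∈ Bd, ∃ T : ℝ, 0 < T ∧ ∃ r : ℝ, 0 < r ∧ volume {q : EuclideanSpace ℝ (Fin 3) |
      ∃ qs : ℕ → EuclideanSpace ℝ (Fin 3), qs 0 = q ∧ (∀ k, Φ T (qs (k + 1)) = qs k) ∧ ∀ k, qs k ∈ ball z r} = 0 := by
    rintro z ⟨hzN, hzR, hbad⟩
    by_cases hc : curl V z = 0
    · -- non-vortical: block data from the true profile `U`, transported by `DV z = DU z`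
      have hcU : curl U z = 0 := by rwa [hcurlEq z hzR] at hc
      have hbadU : ∃ w : EuclideanSpace ℝ (Fin 3), ‖w‖ = 1 ∧ 1 ≤ ⟪fderiv ℝ U z w, w⟫ := by
        rw [← hDeq z hzR]; exact hbad
      obtain ⟨b, lam, β, hA0, hA1, hA2, hshape⟩ :=
        exists_thinBlock_of_curl_eq_zero_of_bad (hU1.differentiable one_ne_zero) hprof.divFree hγ2 hcU hbadU
      rw [← hDeq z hzR] at hA0 hA1 hA2
      rcases hshape with ⟨h2, h20, h21⟩ | ⟨h0, h1, h02, h12⟩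
      · exact C2.Kelvin.exists_trappedSet_null_of_dominatedBlock hV hK hzN b lam β hA0 hA1 hA2 h2 h20 h21
      · exact C2.Kelvin.exists_trappedSet_null_of_contractingPlane hV hK hzN b lam β hA0 hA1 hA2 h0 h1 h02 h12
    · -- vortical: pointwise profile facts from `U`
      have hzNU : z ∈ selfSimilarNodalSet γ 0 U := by
        rw [mem_selfSimilarNodalSet_iff] at hzN ⊢
        have := hWeq z (by linarith)
        simp only [selfSimilarTransport_apply] at this
        rwa [this] at hzN
      have heig : fderiv ℝ V z (curl V z) = curl V z := by
        rw [hDeq z hzR, hcurlEq z hzR]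
        exact hprof.isSelfSimilarEulerVorticityProfile.fderiv_apply_curl_eq_of_mem_nodalSet hzNU
      have hdivz : LinearMap.trace ℝ _ ((fderiv ℝ V z : EuclideanSpace ℝ (Fin 3) →L[ℝ] EuclideanSpace ℝ (Fin 3)) :
          EuclideanSpace ℝ (Fin 3) →ₗ[ℝ] EuclideanSpace ℝ (Fin 3)) = 0 := by
        rw [hDeq z hzR]; exact hprof.divFree z
      exact exists_trappedSet_null_of_curl_ne_zero_loc hV hK (by linarith) hγ2 hzN hc heig hdivz
  have hnull := C2.Kelvin.volume_setOf_tendsto_flow_atBot_mem_eq_zero_of_trappedSets hV hK hBc hthin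
  -- every vortical point near `x₀` flows backward into `Bd`
  have hsubset : {x : EuclideanSpace ℝ (Fin 3) | dist x x₀ < 1 ∧ curl U x ≠ 0} ⊆
      {x : EuclideanSpace ℝ (Fin 3) | ∃ z ∈ Bd, Tendsto (fun s => Φ s x) atBot (𝓝 z)} := by
    rintro x ⟨hx, hcx⟩
    have hxn : ‖x‖ ≤ ‖x₀‖ + 1 := by
      have := norm_le_norm_add_norm_sub' x x₀
      rw [← dist_eq_norm] at this
      linarith
    have hxR : max ‖x‖ R ≤ R₀ := max_le (hxn.trans (le_max_left _ _)) hRR₀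
    -- the globally defined `V`-orbit `Yp t = Φ_{−t} x` and its ONE-SIDED barrier confinement
    set Yp : ℝ → EuclideanSpace ℝ (Fin 3) := fun t => Φ (-t) x with hYp
    have hYpV : ∀ t, HasDerivAt Yp ((-1 : ℝ) • selfSimilarTransport γ 0 V (Yp t)) t :=
      fun t => C2.Kelvin.hasDerivAt_flow_neg (γ := γ) hV1 hK x t
    have hYpc : Continuous Yp := continuous_iff_continuousAt.2 fun t => (hYpV t).continuousAt
    have hYp0 : Yp 0 = x := by simp [hYp, hΦ, ODE.evolutionMap_self]
    have hconf : ∀ t, 0 ≤ t → ‖Yp t‖ ≤ R₀ := fun t ht =>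
      (norm_flow_le_max_of_nonpos_of_inner hV1 hK hκ0 hR hfarV x (s := -t) (by linarith)).trans hxR
    have hYpU : ∀ t, 0 ≤ t → HasDerivAt Yp ((-1 : ℝ) • selfSimilarTransport γ 0 U (Yp t)) t := by
      intro t ht
      have h := hYpV t
      rwa [hWeq (Yp t) (by linarith [hconf t ht])] at h
    have hx0 : curl U (Yp 0) ≠ 0 := by rw [hYp0]; exact hcx
    -- the limit-set kill on the half-orbit
    obtain ⟨z', hz'N, hz'R, hcl', w, hw, hbadw⟩ :=
      NodalContinuum.exists_mapClusterPt_stretching_ge_one_of_Ici hprof hγne hYpc hYpU hconf hx0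
    have hcl : MapClusterPt z' atBot (fun s => Φ s x) := by
      have e : Yp = (fun s => Φ s x) ∘ Neg.neg := rfl
      have hclYp : MapClusterPt z' atTop Yp := hcl'
      rw [e, mapClusterPt_comp, Filter.map_neg_atTop] at hclYp
      exact hclYp
    -- point hypotheses from the profile along the half-orbit
    have htendsYp : Tendsto (fun t => selfSimilarTransport γ 0 V (Yp t)) atTop (𝓝 0) := by
      have h := HalfOrbit.tendsto_transport_comp_of_bounded_of_Ici hprof hγne (σ := -1) (by norm_num) hYpc hYpU hconf
      refine h.congr' ((eventually_ge_atTop (0 : ℝ)).mono fun t ht => ?_)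
      show selfSimilarTransport γ 0 U (Yp t) = selfSimilarTransport γ 0 V (Yp t)
      rw [hWeq (Yp t) (by linarith [hconf t ht])]
    have htends : Tendsto (fun s => selfSimilarTransport γ 0 V (Φ s x)) atBot (𝓝 0) := by
      have h := htendsYp.comp tendsto_neg_atBot_atTop
      refine h.congr fun s => ?_
      simp only [Function.comp_apply, hYp, neg_neg]
    obtain ⟨C, hC⟩ := HalfOrbit.exists_integral_norm_transport_sq_le_of_Ici hprof hγne (σ := -1) (by norm_num)
      hYpc hYpU hconf
    have hcont : Continuous fun t : ℝ => ‖selfSimilarTransport γ 0 V (Φ (-t) x)‖ ^ 2 :=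
      ((((contDiff_selfSimilarTransport (γ := γ) hV).continuous.comp
        ((C2.Kelvin.continuous_flow_apply (γ := γ) hV1 hK x).comp continuous_neg)).norm).pow 2)
    have hint : IntegrableOn (fun t : ℝ => ‖selfSimilarTransport γ 0 V (Φ (-t) x)‖ ^ 2) (Ioi 0) := by
      refine integrableOn_Ioi_of_intervalIntegral_norm_bounded C 0 (l := atTop) (b := fun n : ℕ => (n : ℝ))
        (fun n => (hcont.integrableOn_Icc).mono_set Ioc_subset_Icc_self) tendsto_natCast_atTop_atTop ?_
      refine Eventually.of_forall fun n => ?_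
      have h := hC 0 n le_rfl (Nat.cast_nonneg n)
      refine le_trans (le_of_eq ?_) h
      refine intervalIntegral.integral_congr fun t ht => ?_
      rw [uIcc_of_le (Nat.cast_nonneg n)] at ht
      simp only [Real.norm_eq_abs, abs_pow, abs_norm]
      rw [hWeq (Yp t) (by linarith [hconf t ht.1])]
    -- node facts at `z'`
    have hDz : fderiv ℝ V z' = fderiv ℝ U z' := hDeq z' hz'R
    have hz'NV : z' ∈ selfSimilarNodalSet γ 0 V := by
      rw [mem_selfSimilarNodalSet_iff] at hz'N ⊢
      have := hWeq z' (by linarith)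
      simp only [selfSimilarTransport_apply] at this
      rwa [← this] at hz'N
    have hdiv0 : LinearMap.trace ℝ _ ((fderiv ℝ V z' : EuclideanSpace ℝ (Fin 3) →L[ℝ] EuclideanSpace ℝ (Fin 3)) :
        EuclideanSpace ℝ (Fin 3) →ₗ[ℝ] EuclideanSpace ℝ (Fin 3)) = 0 := by
      rw [hDz]; exact hprof.divFree z'
    have heig : curl V z' ≠ 0 → fderiv ℝ V z' (curl V z') = curl V z' := fun _ => by
      rw [hDz, hcurlEq z' hz'R]
      exact hprof.isSelfSimilarEulerVorticityProfile.fderiv_apply_curl_eq_of_mem_nodalSet hz'N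
    have hbadV : 1 ≤ ⟪fderiv ℝ V z' w, w⟫ := by rw [hDz]; exact hbadw
    obtain ⟨z, hzN, hz⟩ := tendsto_flow_atBot_of_badClusterPt_loc hV hK hVM hγ hγ2 x htends hint hcl hdiv0 heig hw hbadV
    have hzz' : z' = z := eq_of_nhds_neBot (hcl.clusterPt.mono hz)
    exact ⟨z, ⟨hzN, hzz' ▸ hz'R, w, hw, hzz' ▸ hbadV⟩, hz⟩
  -- an open null set is empty
  have hopen : IsOpen {x : EuclideanSpace ℝ (Fin 3) | dist x x₀ < 1 ∧ curl U x ≠ 0} := by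
    have h1 : IsOpen {x : EuclideanSpace ℝ (Fin 3) | dist x x₀ < 1} := isOpen_lt (continuous_id.dist continuous_const) continuous_const
    exact h1.inter (isOpen_ne_fun (differentiable_curl_of_contDiff hU2).continuous continuous_const)
  have hzero : volume {x : EuclideanSpace ℝ (Fin 3) | dist x x₀ < 1 ∧ curl U x ≠ 0} = 0 := measure_mono_null hsubset hnull
  have hempty := (hopen.measure_eq_zero_iff volume).1 hzero
  by_contra hx₀
  have : x₀ ∈ ({x : EuclideanSpace ℝ (Fin 3) | dist x x₀ < 1 ∧ curl U x ≠ 0} : Set _) := ⟨by simp, hx₀⟩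
  rw [hempty] at this
  exact this

/-- Sub-drift growth is the special case `⟪y, U y⟫ ≥ −‖y‖‖U y‖ ≥ −κ‖y‖²` of the radial condition. [folklore] -/
theorem radialInflow_of_subdrift {κ R₁ : ℝ}
    (hR₁ : ∀ y : EuclideanSpace ℝ (Fin 3), R₁ ≤ ‖y‖ → ‖U y‖ ≤ κ * ‖y‖) :
    ∀ y : EuclideanSpace ℝ (Fin 3), R₁ ≤ ‖y‖ → -(κ * ‖y‖ ^ 2) ≤ ⟪y, U y⟫ := by
  intro y hy
  have h := abs_real_inner_le_norm y (U y)
  have h' : |⟪y, U y⟫| ≤ ‖y‖ * (κ * ‖y‖) := h.trans (mul_le_mul_of_nonneg_left (hR₁ y hy) (norm_nonneg _))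
  have := neg_abs_le ⟪y, U y⟫
  nlinarith

/-! ### Member level: the stratum «V ∈ C², no fast inflow at infinity» -/

/-- **THE NO-FAST-INFLOW STRATUM OF `stub_selfSimilarExtremalRest`, MEMBER LEVEL.**  Crux hypotheses verbatim, window
`0 < ρ ≤ ½`, exact self-similarity with profile `(V, P)`: if `V ∈ C²` and `⟪y, V y⟫ ≥ −κ‖y‖²` for `‖y‖ ≥ R₁` with some
`κ < 1/(2+ρ) = γ` (no inward radial velocity faster than the similarity drift; outward / tangential growth free), then
`u = 0` a.e. on `(−∞,0) × ℝ³`: CIV (3.3) holds classically for some `C¹` pressure (`WeakToClassical`), the profile is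
irrotational (`curl_eq_zero_of_radialInflow`), and the LEAD's growth-free Liouville endgame
`Loc.selfSimilar_ae_eq_zero_of_irrotationalC2_profile` (the member's own `A`-gauge) finishes. [folklore] -/
theorem selfSimilar_ae_eq_zero_of_radialInflowC2_profile {ρ : ℝ} (hρ : 0 < ρ) (hρ1 : ρ ≤ 1 / 2)
    {u : ℝ → EuclideanSpace ℝ (Fin 3) → EuclideanSpace ℝ (Fin 3)} {p : ℝ → EuclideanSpace ℝ (Fin 3) → ℝ}
    {H : ℝ → EuclideanSpace ℝ (Fin 3) → EuclideanSpace ℝ (Fin 3) →L[ℝ] EuclideanSpace ℝ (Fin 3)} {c : ℝ≥0}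
    (hsw : IsSuitableWeakSolutionOn (slab (EuclideanSpace ℝ (Fin 3)) (Iio 0) isOpen_Iio) 0 0 u p)
    (hgauge : ∀ a : ℝ, 0 < a →
      ENNReal.ofReal (a ^ (2 * ρ)) * cknA a (0 : ℝ × EuclideanSpace ℝ (Fin 3)) u +
          ENNReal.ofReal (a ^ ρ) * cknE a (0 : ℝ × EuclideanSpace ℝ (Fin 3)) H +
        ENNReal.ofReal (a ^ (2 * ρ)) * cknD a (0 : ℝ × EuclideanSpace ℝ (Fin 3)) p ≤ (c : ℝ≥0∞))
    {V : EuclideanSpace ℝ (Fin 3) → EuclideanSpace ℝ (Fin 3)} {P : EuclideanSpace ℝ (Fin 3) → ℝ}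
    (hu : ∀ τ : ℝ, τ < 0 → u τ = selfSimilarCollapse (1 / (2 + ρ)) 0 V τ)
    (hp : ∀ τ : ℝ, τ < 0 → p τ = selfSimilarCollapsePressure (1 / (2 + ρ)) 0 P τ)
    (hV : ContDiff ℝ 2 V) {κ R₁ : ℝ} (hκ : κ < 1 / (2 + ρ))
    (hR₁ : ∀ y : EuclideanSpace ℝ (Fin 3), R₁ ≤ ‖y‖ → -(κ * ‖y‖ ^ 2) ≤ ⟪y, V y⟫) :
    uncurry u =ᵐ[volume.restrict (Iio (0 : ℝ) ×ˢ (univ : Set (EuclideanSpace ℝ (Fin 3))))] 0 := by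
  have hρ1' : ρ < 1 := by linarith
  have h2ρ : (0 : ℝ) < 2 + ρ := by linarith
  have hγ : (0 : ℝ) < 1 / (2 + ρ) := one_div_pos.2 h2ρ
  have hγ2 : 1 / (2 + ρ) < 1 / 2 := one_div_lt_one_div_of_lt two_pos (by linarith)
  have hA : ∀ a : ℝ, 0 < a → ENNReal.ofReal (a ^ (2 * ρ)) *
      cknA a (0 : ℝ × EuclideanSpace ℝ (Fin 3)) u ≤ (c : ℝ≥0∞) :=
    fun a ha => le_trans (le_trans le_self_add le_self_add) (hgauge a ha)
  have hD : ∀ a : ℝ, 0 < a → ENNReal.ofReal (a ^ (2 * ρ)) *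
      cknD a (0 : ℝ × EuclideanSpace ℝ (Fin 3)) p ≤ (c : ℝ≥0∞) :=
    fun a ha => le_trans le_add_self (hgauge a ha)
  have hpm : AEStronglyMeasurable (uncurry p)
      (volume.restrict (Iio (0 : ℝ) ×ˢ (univ : Set (EuclideanSpace ℝ (Fin 3))))) := by
    have := hsw.distributional.2.2.1.aestronglyMeasurable
    simpa [slab] using this
  have hPm := aestronglyMeasurable_pressureProfile hpm hp
  have hDprof := profile_pressure_weight_of_gaugeD hρ hρ1' hpm hp hD
  have hP1 : LocallyIntegrable P volume :=
    EnergySaturation.locallyIntegrable_pressure_of_weight hρ1' hPm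
      (ENNReal.mul_ne_top ENNReal.ofReal_ne_top ENNReal.coe_ne_top) hDprof
  obtain ⟨P', hprof⟩ := WeakToClassical.exists_isSelfSimilarEulerProfile_of_contDiff hsw.distributional hu hp hV hP1
  have hcurl := curl_eq_zero_of_radialInflow hprof hκ hR₁ hγ hγ2
  exact Loc.selfSimilar_ae_eq_zero_of_irrotationalC2_profile hρ hsw.distributional hA hu hV hcurl

end Summit.NavierStokesRegularity.NavierStokesRegularity.Theorems.PowerGaugeEulerLiouville.Loc

end
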